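import Summits.ResolutionOfSingularities.ResolutionOfSingularities.Theorems.CofactorCutKernels
import HarnessLib

/-! # CofactorCutKernels2 — decomp-res-lens-4 g39 «CofactorCut», FILE B (§126 the non-principal factor law (L1′) and the cofactor law:
a birth-free factor chain of an occult rd-3 tower over a field is eventually isolated or the tower follows a curve germ). -/

set_option linter.dupNamespace false
set_option linter.unusedSectionVars false

noncomputable section

open CategoryTheory AlgebraicGeometry IsLocalRing TopologicalSpace
open Literature.AlgebraicGeometry.Resolution
open Summit.ResolutionOfSingularities.ResolutionOfSingularities.Theorems
open WeakOrderReduction ForcedTowerClasses DivergentTowerClasses MonomialTowerClasses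
open HugDimensionClasses HugDimensionKernels SurfaceShadowClasses SurfaceShadowKernels
open NearPointCut (SingularClass)
open Scheme.IdealSheafData (vanishingIdeal)

universe u

namespace Summit.ResolutionOfSingularities.ResolutionOfSingularities.Theorems.HugValuationCut

/-! ## ══ FILE B `Theorems/CofactorCutKernels2.lean` (§126; cone-free; imports FILE A) ══ -/

section FactorStructure

/-! ## §126 (g39 · NEW · KERNEL) THE FACTOR LAW — g38's near-branch structure and birth-count dichotomy WITHOUT PRINCIPALITY

(L1′) For an ARBITRARY factor `G` (weight `a ≥ 1`) of the marked stalk of an OCCULT tower: a near-branch prime `𝔭_η ⊂ 𝒪_{x_i}` that is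
principal, `𝔭_η = (s)`, forces `s^a ∣ g` for EVERY `g ∈ G_{x_i}` (`ord_η G ≥ a` in the DVR `(𝒪_{x_i})_{(s)}`, Literature
`pow_dvd_of_algebraMap_mem_map_pow`), and since `ord_{x_i} G = a` exactly some `g₀ = s^a·unit`, so `G_{x_i} = (s^a)` IS PRINCIPAL —
and then g38's (L1a) `not_isPrincipal_primeOfSpecializes_of_mem_brSet` (occultness) refutes it.  Hence (L1b′)–(L1e′): near-branch
primes of any factor have height 2, near-branches are maximal points of the weight locus, FINITE, of dimension one — and g38's
transport/count law (L2)–(L4) + the kernel recursion `followsCurveTower_of_branch_chain` run for ANY factor: a BIRTH-FREE factor is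
EVENTUALLY ISOLATED in its own top locus or the tower FOLLOWS A CURVE GERM.  Applied to the COFACTOR: (KFB) ⟹ (KI∞) ∨ (CF∞). -/

variable {k : Type} [Field k]

/-- **(L1′-key) A FACTOR WITH A PRINCIPAL NEAR-BRANCH PRIME IS PRINCIPAL**: if `η` is a near-branch of the factor `G` (weight `a`,
`ord_{x_i} G = a`) and `𝔭_η = (s)`, then `s^a` divides every element of `G_{x_i}` and `G_{x_i} = (s^a)`.
(Sources: Matsumura1987, Thms. 11.2, 20.3; GortzWedhorn2020, Prop. B.75; StacksProject, Tag 01J7.) -/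
theorem isPrincipal_stalkIdeal_of_isPrincipal_primeOfSpecializes (T : ForcedTower) (g : T.St 0 ⟶ Spec (.of k))
    (hB : IsBase (T.St 0) g) {i a b : ℕ} {G K : (T.St i).IdealSheafData} (hF : FactorAt T i a b G K) (ha : 1 ≤ a)
    {η : T.St i} (hη : η ∈ brSet T i a G) (hprin : (primeOfSpecializes hη.1).IsPrincipal) :
    (stalkIdeal G (T.pt i)).IsPrincipal := by
  haveI := (tower_isLocallyNoetherian_isRegular T g hB i).1
  have hreg := tower_isRegular T g hB i
  haveI : IsRegularLocalRing ((T.St i).presheaf.stalk (T.pt i)) := hreg _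
  haveI : IsDomain ((T.St i).presheaf.stalk (T.pt i)) := isDomain_of_isRegularLocalRing _
  haveI : UniqueFactorizationMonoid ((T.St i).presheaf.stalk (T.pt i)) := hreg.uniqueFactorizationMonoid_stalk _
  obtain ⟨⟨s, hs⟩⟩ := hprin
  change primeOfSpecializes hη.1 = Ideal.span {s} at hs
  set φ := ((T.St i).presheaf.stalkSpecializes hη.1).hom with hφ
  -- `G_η = G_{x_i}·𝒪_η ⊆ 𝔪_η^a`
  have h1 : stalkIdeal G η ≤ maximalIdeal _ ^ a := (le_idealOrder_iff G η a).mp hη.2.2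
  have h2 : stalkIdeal G η = (stalkIdeal G (T.pt i)).map φ := (stalkIdeal_map_stalkSpecializes G hη.1).symm
  have hφg : ∀ g' ∈ stalkIdeal G (T.pt i), φ g' ∈ maximalIdeal _ ^ a := fun g' hg' =>
    h1 (h2 ▸ Ideal.mem_map_of_mem φ hg')
  -- the order of `G` at `x_i` is exactly `a`
  have hGa : ¬ stalkIdeal G (T.pt i) ≤ maximalIdeal _ ^ (a + 1) := by
    rw [← le_idealOrder_iff, hF.2.1, Nat.cast_le]
    omega
  -- every element of `G_{x_i}` lies in `𝔮`
  have hmem : ∀ g' ∈ stalkIdeal G (T.pt i), g' ∈ primeOfSpecializes hη.1 := fun g' hg' => by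
    change g' ∈ (maximalIdeal _).comap φ
    rw [Ideal.mem_comap]
    exact Ideal.pow_le_self (by omega) (hφg g' hg')
  by_cases hs0 : s = 0
  · -- `𝔮 = (0)`: then `G_{x_i} = 0`, of infinite order
    exfalso
    apply hGa
    intro g' hg'
    have h0 := hmem g' hg'
    rw [hs, hs0, Ideal.span_singleton_eq_bot.mpr rfl, Ideal.mem_bot] at h0
    rw [h0]
    exact zero_mem _
  -- `𝔮 = (s)` with `s` a prime element; `𝒪_η = (𝒪_{x_i})_𝔮`
  have hsP : Prime s := (Ideal.span_singleton_prime hs0).mp (hs ▸ inferInstance)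
  letI := φ.toAlgebra
  haveI : IsLocalization.AtPrime ((T.St i).presheaf.stalk η) (primeOfSpecializes hη.1) :=
    isLocalizationAtPrime_stalkSpecializes hη.1
  -- `s^a` divides every element of `G_{x_i}`
  have hdvd : ∀ g' ∈ stalkIdeal G (T.pt i), s ^ a ∣ g' := fun g' hg' => by
    have hf : algebraMap _ ((T.St i).presheaf.stalk η) g' ∈
        ((primeOfSpecializes hη.1) ^ a).map (algebraMap _ ((T.St i).presheaf.stalk η)) := by
      rw [Ideal.map_pow, IsLocalization.AtPrime.map_eq_maximalIdeal (primeOfSpecializes hη.1) ((T.St i).presheaf.stalk η)]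
      exact hφg g' hg'
    exact pow_dvd_of_algebraMap_mem_map_pow (primeOfSpecializes hη.1) hsP hs hf
  have hsm : s ∈ maximalIdeal _ :=
    (IsLocalRing.le_maximalIdeal (Ideal.IsPrime.ne_top inferInstance) : primeOfSpecializes hη.1 ≤ _)
      (hs ▸ Ideal.mem_span_singleton_self s)
  -- some element of `G_{x_i}` is `s^a` times a UNIT (else `G_{x_i} ⊆ s^a·𝔪 ⊆ 𝔪^{a+1}`)
  obtain ⟨g₀, hg₀, t₀, ht₀, ht₀u⟩ : ∃ g₀ ∈ stalkIdeal G (T.pt i), ∃ t₀, g₀ = s ^ a * t₀ ∧ IsUnit t₀ := by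
    by_contra hno
    push Not at hno
    apply hGa
    intro g' hg'
    obtain ⟨t, ht⟩ := hdvd g' hg'
    have htm : t ∈ maximalIdeal _ := (IsLocalRing.mem_maximalIdeal t).mpr (hno g' hg' t ht)
    rw [ht, pow_succ]
    exact Ideal.mul_mem_mul (Ideal.pow_mem_pow hsm a) htm
  refine ⟨⟨s ^ a, le_antisymm (fun g' hg' => ?_) ?_⟩⟩
  · obtain ⟨t, ht⟩ := hdvd g' hg'
    show g' ∈ Ideal.span {s ^ a}
    rw [ht]
    exact Ideal.mul_mem_right t _ (Ideal.mem_span_singleton_self _)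
  · show Ideal.span {s ^ a} ≤ stalkIdeal G (T.pt i)
    rw [Ideal.span_singleton_le_iff_mem]
    have hsa : s ^ a = g₀ * ↑(ht₀u.unit⁻¹) := by
      rw [ht₀, mul_assoc, IsUnit.mul_val_inv, mul_one]
    rw [hsa]
    exact Ideal.mul_mem_right _ _ hg₀

/-- **(L1a′) OCCULTNESS EXCLUDES REGULAR-SURFACE NEAR-BRANCHES OF EVERY FACTOR** — no near-branch prime of any factor of positive
weight of the marked stalk of an occult tower is principal ((L1′-key) + g38's (L1a) BY NAME). [folklore] -/
theorem not_isPrincipal_primeOfSpecializes_of_mem_brSet' (T : ForcedTower) (g : T.St 0 ⟶ Spec (.of k))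
    (hB : IsBase (T.St 0) g) (hocc : ¬ LatentFactorTower T) {i a b : ℕ} {G K : (T.St i).IdealSheafData}
    (hF : FactorAt T i a b G K) (ha : 1 ≤ a) {η : T.St i} (hη : η ∈ brSet T i a G) :
    ¬ (primeOfSpecializes hη.1).IsPrincipal := fun hprin =>
  not_isPrincipal_primeOfSpecializes_of_mem_brSet T g hB hocc hF
    (isPrincipal_stalkIdeal_of_isPrincipal_primeOfSpecializes T g hB hF ha hη hprin) ha hη hprin

/-- **(L1b′) NEAR-BRANCH PRIMES OF ANY FACTOR HAVE HEIGHT EXACTLY TWO** (rd 3; as g38 (L1b) with (L1a′)). [folklore] -/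
theorem height_primeOfSpecializes_eq_two_of_mem_brSet' (T : ForcedTower) (g : T.St 0 ⟶ Spec (.of k))
    (hB : IsBase (T.St 0) g) (hocc : ¬ LatentFactorTower T) (h3 : ThreefoldTower T) {i a b : ℕ}
    {G K : (T.St i).IdealSheafData} (hF : FactorAt T i a b G K) (ha : 1 ≤ a)
    {η : T.St i} (hη : η ∈ brSet T i a G) : (primeOfSpecializes hη.1).height = 2 := by
  haveI := (tower_isLocallyNoetherian_isRegular T g hB i).1
  have hreg := tower_isRegular T g hB i
  haveI : IsRegularLocalRing ((T.St i).presheaf.stalk (T.pt i)) := hreg _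
  haveI : IsDomain ((T.St i).presheaf.stalk (T.pt i)) := isDomain_of_isRegularLocalRing _
  haveI : UniqueFactorizationMonoid ((T.St i).presheaf.stalk (T.pt i)) := hreg.uniqueFactorizationMonoid_stalk _
  have hnp := not_isPrincipal_primeOfSpecializes_of_mem_brSet' T g hB hocc hF ha hη
  have hlt : primeOfSpecializes hη.1 < maximalIdeal _ :=
    lt_of_le_of_ne (IsLocalRing.le_maximalIdeal (Ideal.IsPrime.ne_top inferInstance))
      (primeOfSpecializes_ne_maximalIdeal_of_ne hη.1 hη.2.1)
  have hm3 := height_maximalIdeal_eq_three T g hB h3 i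
  have hq3 : (primeOfSpecializes hη.1).height < 3 := hm3 ▸ Ideal.height_strict_mono_of_isPrime_of_isPrime hlt
  have hq1 : ¬ (primeOfSpecializes hη.1).height ≤ 1 := fun h => hnp (isPrincipal_of_height_le_one h)
  obtain ⟨d, hd⟩ := ENat.ne_top_iff_exists.mp hq3.ne_top
  rw [← hd] at hq3 hq1 ⊢
  have h3' : d < 3 := by exact_mod_cast hq3
  have h1' : ¬ d ≤ 1 := by exact_mod_cast hq1
  obtain rfl : d = 2 := by omega
  rfl

/-- **(L1c′) NEAR-BRANCHES OF ANY FACTOR ARE MAXIMAL POINTS of its weight locus** (as g38 (L1c)). [folklore] -/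
theorem brSet_subset_maxPoints' (T : ForcedTower) (g : T.St 0 ⟶ Spec (.of k)) (hB : IsBase (T.St 0) g)
    (hocc : ¬ LatentFactorTower T) (h3 : ThreefoldTower T) {i a b : ℕ} {G K : (T.St i).IdealSheafData}
    (hF : FactorAt T i a b G K) (ha : 1 ≤ a) :
    brSet T i a G ⊆ maxPoints {z : T.St i | ((a : ℕ) : ℕ∞) ≤ idealOrder G z} := by
  intro η hη
  refine ⟨hη.2.2, fun η' hη' hs => ?_⟩
  by_contra hne
  have hη'b : η' ∈ brSet T i a G :=
    ⟨hs.trans hη.1, fun h => hη.2.1 (hη.1.antisymm (h ▸ hs)).eq, hη'⟩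
  haveI : IsRegularLocalRing ((T.St i).presheaf.stalk (T.pt i)) := tower_isRegular T g hB i _
  have hlt := Ideal.height_strict_mono_of_isPrime_of_isPrime
    (primeOfSpecializes_lt_of_specializes_of_ne hη.1 hη'b.1 hs hne)
  rw [height_primeOfSpecializes_eq_two_of_mem_brSet' T g hB hocc h3 hF ha hη,
    height_primeOfSpecializes_eq_two_of_mem_brSet' T g hB hocc h3 hF ha hη'b] at hlt
  exact lt_irrefl _ hlt

/-- **(L1d′) THE NEAR-BRANCHES OF ANY FACTOR ARE FINITELY MANY** (as g38 (L1d)). [folklore] -/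
theorem brSet_finite' (T : ForcedTower) (g : T.St 0 ⟶ Spec (.of k)) (hB : IsBase (T.St 0) g)
    (hocc : ¬ LatentFactorTower T) (h3 : ThreefoldTower T) {i a b : ℕ} {G K : (T.St i).IdealSheafData}
    (hF : FactorAt T i a b G K) (ha : 1 ≤ a) : (brSet T i a G).Finite := by
  haveI := (tower_isLocallyNoetherian_isRegular T g hB i).1
  obtain ⟨U, hU, hxU, hfin⟩ :=
    exists_isOpen_finite_maxPoints_inter (isClosed_setOf_le_idealOrder_tower T g hB i G a) (T.pt i)
  exact hfin.subset fun η hη => ⟨brSet_subset_maxPoints' T g hB hocc h3 hF ha hη, hη.1.mem_open hU hxU⟩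

/-- **(L1e′) A NEAR-BRANCH OF ANY FACTOR IS A CURVE GERM: `dim 𝒪_{x_i}/𝔮 = 1`** (as g38 (L1e)). [folklore] -/
theorem ringKrullDim_quotient_primeOfSpecializes_eq_one_of_mem_brSet' (T : ForcedTower) (g : T.St 0 ⟶ Spec (.of k))
    (hB : IsBase (T.St 0) g) (hocc : ¬ LatentFactorTower T) (h3 : ThreefoldTower T) {i a b : ℕ}
    {G K : (T.St i).IdealSheafData} (hF : FactorAt T i a b G K) (ha : 1 ≤ a)
    {η : T.St i} (hη : η ∈ brSet T i a G) :
    ringKrullDim ((T.St i).presheaf.stalk (T.pt i) ⧸ primeOfSpecializes hη.1) = 1 := by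
  haveI : IsRegularLocalRing ((T.St i).presheaf.stalk (T.pt i)) := tower_isRegular T g hB i _
  have hform := height_add_ringKrullDim_quotient (primeOfSpecializes hη.1)
  rw [ringKrullDim_eq_three_of_threefoldTower h3 i, height_primeOfSpecializes_eq_two_of_mem_brSet' T g hB hocc h3 hF ha hη]
    at hform
  revert hform
  generalize ringKrullDim ((T.St i).presheaf.stalk (T.pt i) ⧸ primeOfSpecializes hη.1) = d
  intro hform
  induction d using WithBot.recBotCoe with
  | bot => exact absurd hform (by simp)
  | coe e =>
    induction e using ENat.recTopCoe with
    | top =>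
      have h : ((2 : ℕ∞) : WithBot ℕ∞) + ((⊤ : ℕ∞) : WithBot ℕ∞) = ((3 : ℕ∞) : WithBot ℕ∞) := hform
      rw [← WithBot.coe_add, WithBot.coe_inj, add_top] at h
      exact absurd h (by simp)
    | coe n =>
      have h : ((2 : ℕ∞) : WithBot ℕ∞) + ((n : ℕ∞) : WithBot ℕ∞) = ((3 : ℕ∞) : WithBot ℕ∞) := hform
      rw [← WithBot.coe_add, WithBot.coe_inj] at h
      have h' : (2 : ℕ) + n = 3 := by exact_mod_cast h
      have hn : n = 1 := by omega
      subst hn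
      rfl

/-- **THE FACTOR LAW — g38's DICHOTOMY FOR AN ARBITRARY FACTOR (KERNEL, PORT-FREE; every `p`, field, weight)**: in an OCCULT forced
tower of ring dimension 3, a factor `G` of positive weight `a` of the marked stalk at stage `m` (`FactorAt T m a b G K`, no principality)
whose chain `G_j = facIter T m a G j` is BIRTH-FREE either ISOLATES the marked points in `Top(G_j, a)` from some stage on, or makes the
tower FOLLOW A CURVE GERM.  Proof = g38's (L2)–(L4) + kernel recursion verbatim, with (L1′) in place of (L1).
(Sources: CossartJannsenSaito2020 §4 p.58, §13 (13.13) p.141; CossartPiltant2019 p.408 (6.6)–(6.7); Matsumura1987 Thms. 14.2, 20.3.) -/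
theorem eventuallyIsolated_or_followsCurve_of_birthFree_factor (T : ForcedTower) (g : T.St 0 ⟶ Spec (.of k))
    (hB : IsBase (T.St 0) g) {n : ℕ} (hD : IsDatum n (T.D 0)) (hocc : ¬ LatentFactorTower T) (h3 : ThreefoldTower T)
    {m a b : ℕ} {G K : (T.St m).IdealSheafData} (hF : FactorAt T m a b G K) (ha : 1 ≤ a) (hfree : ∀ j, ¬ BornAt T m a G j) :
    (∃ j₁, ∀ d, IsIsolatedIn (companionMarked T (m + j₁) a (facIter T m a G j₁) d).support (T.pt (m + j₁ + d))) ∨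
      FollowsCurveTower T := by
  haveI : ∀ i, IsLocallyNoetherian (T.St i) := fun i => (tower_isLocallyNoetherian_isRegular T g hB i).1
  let f : ℕ → ℕ := fun j => (branchSet T m a G j).ncard
  have hfinj : ∀ j, (branchSet T m a G j).Finite := fun j =>
    brSet_finite' T g hB hocc h3 (hF.forcing T g hB hD j) ha
  have hanti : ∀ j, f (j + 1) ≤ f j := fun j =>
    ncard_brSet_succ_le T (m + j) a (facIter T m a G j) (hfinj j) (hfree j)
  have hdesc : ∀ j d, f (j + d) ≤ f j := by
    intro j d
    induction d with
    | zero => exact le_rfl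
    | succ d ih => exact (hanti (j + d)).trans ih
  obtain ⟨j₁, hj₁⟩ : ∃ j₁, ∀ j, f j₁ ≤ f j := ⟨Function.argmin f, fun j => Function.argmin_le f j⟩
  have hconst : ∀ d, f (j₁ + d) = f j₁ := fun d => le_antisymm (hdesc j₁ d) (hj₁ _)
  -- re-root at the stabilisation stage `m₁ = m + j₁`
  have hF₁ := hF.forcing T g hB hD j₁
  have hfree₁ := birthFree_add T m a G hfree j₁
  have hfin₁ : ∀ d, (branchSet T (m + j₁) a (facIter T m a G j₁) d).Finite := fun d =>
    brSet_finite' T g hB hocc h3 (hF₁.forcing T g hB hD d) ha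
  have hcnt : ∀ d, (branchSet T (m + j₁) a (facIter T m a G j₁) d).ncard = f j₁ := fun d => by
    rw [ncard_branchSet_add]
    exact hconst d
  by_cases hc : f j₁ = 0
  · -- `μ ≡ 0`: THE FACTOR IS ISOLATED from stage `m₁` on
    left
    refine ⟨j₁, fun d => ?_⟩
    have he : branchSet T (m + j₁) a (facIter T m a G j₁) d = ∅ :=
      (Set.ncard_eq_zero (hfin₁ d)).mp ((hcnt d).trans hc)
    have hsupp : ((companionMarked T (m + j₁) a (facIter T m a G j₁) d).support : Set (T.St (m + j₁ + d))) =
        {y | ((a : ℕ) : ℕ∞) ≤ idealOrder (facIter T (m + j₁) a (facIter T m a G j₁) d) y} :=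
      Set.ext fun y => mem_support_companionMarked_iff T (m + j₁) a (facIter T m a G j₁) d y
    rw [hsupp]
    exact isIsolatedIn_of_brSet_eq_empty T g hB (m + j₁ + d) a _ (hF₁.forcing T g hB hD d).2.1.ge he
  · -- `μ ≡ c ≥ 1`: A NEAR-BRANCH PERSISTS — the tower follows a curve germ
    right
    have hsurj : ∀ d, ∀ ζ ∈ branchSet T (m + j₁) a (facIter T m a G j₁) d,
        ∃ η ∈ branchSet T (m + j₁) a (facIter T m a G j₁) (d + 1), (T.π (m + j₁ + d)).base η = ζ :=
      fun d ζ hζ => exists_preimage_of_ncard_eq T (m + j₁ + d) a (facIter T (m + j₁) a (facIter T m a G j₁) d)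
        (hfin₁ d) (hfree₁ d) ((hcnt (d + 1)).trans (hcnt d).symm) hζ
    obtain ⟨η₀, hη₀⟩ : (branchSet T (m + j₁) a (facIter T m a G j₁) 0).Nonempty :=
      Set.nonempty_of_ncard_ne_zero (by rw [hcnt 0]; exact hc)
    exact followsCurveTower_of_branch_chain T (m + j₁) a (facIter T m a G j₁) hsurj hη₀
      (ringKrullDim_quotient_primeOfSpecializes_eq_one_of_mem_brSet' T g hB hocc h3 hF₁ ha hη₀)

/-- **THE COFACTOR DICHOTOMY (KFB) ⟹ (KI∞) ∨ (CF∞)** (the factor law applied to the cofactor of a principal companion; the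
factorization re-rooted at the stabilisation stage is again a principal-companion datum by `FactorAt.forcing` /
`FactorAt.principal_facIter`). [folklore] -/
theorem isolatedCofactor_or_followsCurve_of_birthFreeCofactor (T : ForcedTower) (g : T.St 0 ⟶ Spec (.of k))
    (hB : IsBase (T.St 0) g) {n : ℕ} (hD : IsDatum n (T.D 0)) (hocc : ¬ LatentFactorTower T) (h3 : ThreefoldTower T)
    (hKFB : BirthFreeCofactorTower T) : IsolatedCofactorTower T ∨ FollowsCurveTower T := by
  obtain ⟨m, a, b, H, K, hF, ha, hP, hb, hfree⟩ := hKFB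
  rcases eventuallyIsolated_or_followsCurve_of_birthFree_factor T g hB hD hocc h3 hF.symm hb hfree with ⟨j₁, hI⟩ | hC
  · left
    exact ⟨m + j₁, a, b, facIter T m a H j₁, facIter T m b K j₁, hF.forcing T g hB hD j₁, ha,
      (hF.principal_facIter T g hB hD hP j₁).1, hb, hI⟩
  · exact Or.inr hC

/-- **THE COFACTOR LAW (stage form; every `p`, field, class `P`, weight)**: NO occult forced tower of ring dimension 3 that
isolates no cofactor and follows no curve germ has a birth-free cofactor. [folklore] -/
theorem noTower_occult_threefold_birthFreeCofactor (n : ℕ) (P : ForcedTower → Prop) :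
    NoTower n fun T => ((((P T ∧ ¬ LatentFactorTower T) ∧ ThreefoldTower T) ∧ ¬ IsolatedCofactorTower T) ∧
      ¬ FollowsCurveTower T) ∧ BirthFreeCofactorTower T := by
  intro p hp K _ _ T g hB hD hE hT
  obtain ⟨⟨⟨⟨⟨-, hocc⟩, h3⟩, hI⟩, hC⟩, hKFB⟩ := hT
  rcases isolatedCofactor_or_followsCurve_of_birthFreeCofactor T g hB hD hocc h3 hKFB with h | h
  exacts [hI h, hC h]

/-- the cofactor law on the wild column. [folklore] -/
theorem noTowerWild_occult_threefold_birthFreeCofactor (n : ℕ) (P : ForcedTower → Prop) :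
    NoTowerWild n fun T => ((((P T ∧ ¬ LatentFactorTower T) ∧ ThreefoldTower T) ∧ ¬ IsolatedCofactorTower T) ∧
      ¬ FollowsCurveTower T) ∧ BirthFreeCofactorTower T :=
  fun p hp _ K _ _ T g hB hD hE hT => noTower_occult_threefold_birthFreeCofactor n P p hp K T g hB hD hE hT

/-- **THE COFACTOR LAW IN MINIMAL CURRENCY**: a MINIMAL occult forced tower of ring dimension 3 following no curve germ has NO
birth-free cofactor — the isolated side is the descent law, the curve side the cell's letter. [folklore] -/
theorem noTower_occult_threefold_curveFree_birthFreeCofactor_of_minimal (n : ℕ) (P : ForcedTower → Prop)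
    (hmin : MinimalAt n) :
    NoTower n fun T => (((P T ∧ ¬ LatentFactorTower T) ∧ ThreefoldTower T) ∧ ¬ FollowsCurveTower T) ∧
      BirthFreeCofactorTower T := by
  intro p hp K _ _ T g hB hD hE hT
  obtain ⟨⟨⟨⟨hP, hocc⟩, h3⟩, hC⟩, hKFB⟩ := hT
  rcases isolatedCofactor_or_followsCurve_of_birthFreeCofactor T g hB hD hocc h3 hKFB with h | h
  · exact noTower_isolatedCofactor_of_minimal n P hmin p hp K T g hB hD hE ⟨hP, h⟩
  · exact hC h

end FactorStructure

end Summit.ResolutionOfSingularities.ResolutionOfSingularities.Theorems.HugValuationCut
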